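import Mathlib
import HarnessLib

/-!
# CM Manin period — the non-cancellation lemma and the elementary algebra of the line card `cm-manin-period`
# (seed crux `SignedMuSeedAtTwoPlus` stmt-BirchSwinnertonDyer-21438; parent Kμ⁺ `SignedMuVanishingAtTwoPlus` stmt-BirchSwinnertonDyer-20689,
# route ResidualThetaTransportAtTwo; card `Cruxes/SignedMuSeedAtTwoPlus/Ideas/cm-manin-period.md`, k1 g28)

Cell `bsd-wall`, width seat `bsd-wall-rtt-p4-w2` g16 (`--supports`, closes nothing).  THEOREMS ONLY; BSD is not proved by this.

The card proves E4 («the theta partner's cohomological plus period is `(Ω_K^{Nér}/2)·unit`») GL₂-side; its steps (a)–(e) are geometric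
(Buzzard multiplicity one, Česnavičius' 𝔪-local Manin theorem, inert rigidity, Serre tensor construction).  This file carries the
ELEMENTARY ALGEBRA of steps (b), (f), (g), over arbitrary commutative (local) rings:

* `not_both_mem_maximalIdeal` — in a local ring, `a·c − b` a unit ⇒ `a` or `b` is a unit;
* **`reIm_nonCancellation`** (step (f), the card's «first lemma», re-proved here from its printed statement so that it lives under `Theorems/`):
  for a ring endomorphism `σ` (informally complex conjugation on `𝒪̄_(𝔓)`), `ε` (informally `Ω̄/Ω`), `ω` with `ω − σω` a unit (informally
  `ω = (1+√d_K)/2`, `√d_K` a `2`-unit since `d_K ≡ 5 (mod 8)`) and a unit `x`: `x + ε·σx` or `xω + ε·σx·σω` is a unit — i.e. of the two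
  periods `x`, `xω` at least one has `2 Re(Ω·)/Ω` a `𝔓`-unit;
* **`exists_mem_isUnit_add_mul_map`** — packaging for step (e)/(f): a subset of periods stable under `y ↦ yω` (an `𝒪_K = ℤ[ω]`-lattice
  `Ω·ℓ_g(𝔐)·𝒪_K`) that contains a unit (primitivity of `ℓ_g`) contains a `y` with `y + ε·σy` a unit («`min_γ v_𝔓(2 Re ∫_γ ω_g / Ω) = 0`»);
* `isUnit_of_ringHom_eq_mul` — step (b)/P3 core: a ring homomorphism `λ : T →+* O` is a PRIMITIVE vector of `Hom(T, O)`: if `λ = p·μ`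
  pointwise then `p` is a unit (`λ 1 = 1`);
* `trace_orderThree_sub_sub_one` — step (g): in characteristic `2`, for `ζ² + ζ + 1 = 0` and `ℓ` odd, `(ζ + ζ²) − ℓ − 1 = 1`
  (informally `a_ℓ(g) − ℓ − 1` is a `𝔓`-unit for `Frob_ℓ` of order `3`, `ℓ` split in `K`).

[folklore]
-/

set_option autoImplicit false
-- the Theorems namespace of this sub repeats the summit name by design (D-0017 nested layout)
set_option linter.dupNamespace false

namespace Summit.BirchSwinnertonDyer.BirchSwinnertonDyer.Theorems.SignedMuAtTwo.CMManinPeriod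

/-! ## Non-cancellation in a local ring (step (f)) -/

section NonCancellation

variable {R : Type*} [CommRing R] [IsLocalRing R]

/-- In a local ring: if `a * c - b` is a unit then `a` or `b` is a unit (both in the maximal ideal would put `a * c - b` there). [folklore] -/
theorem not_both_mem_maximalIdeal {a b c : R} (h : IsUnit (a * c - b)) : IsUnit a ∨ IsUnit b := by
  by_contra hab
  rw [not_or] at hab
  have ha : a ∈ IsLocalRing.maximalIdeal R := (IsLocalRing.mem_maximalIdeal a).mpr hab.1
  have hb : b ∈ IsLocalRing.maximalIdeal R := (IsLocalRing.mem_maximalIdeal b).mpr hab.2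
  have hmem : a * c - b ∈ IsLocalRing.maximalIdeal R :=
    Ideal.sub_mem _ (Ideal.mul_mem_right c _ ha) hb
  exact (IsLocalRing.mem_maximalIdeal _).mp hmem h

/-- **Non-cancellation lemma** (card `cm-manin-period`, step (f)): for a ring endomorphism `σ`, any `ε`, an `ω` with `ω − σ ω` a unit and a
unit `x`, at least one of `x + ε σx` and `x ω + ε σx σω` is a unit.  Proof: `(x + ε σx)·σω − (xω + ε σx σω) = −x(ω − σω)` is a unit.
[folklore] -/
theorem reIm_nonCancellation (σ : R →+* R) (ε ω x : R) (hω : IsUnit (ω - σ ω)) (hx : IsUnit x) :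
    IsUnit (x + ε * σ x) ∨ IsUnit (x * ω + ε * σ x * σ ω) := by
  refine not_both_mem_maximalIdeal (c := σ ω) ?_
  have h : (x + ε * σ x) * σ ω - (x * ω + ε * σ x * σ ω) = -(x * (ω - σ ω)) := by ring
  rw [h]
  exact (hx.mul hω).neg

/-- The same with `σ` applied inside: `x + ε σx` or `xω + ε σ(xω)` is a unit. [folklore] -/
theorem reIm_nonCancellation' (σ : R →+* R) (ε ω x : R) (hω : IsUnit (ω - σ ω)) (hx : IsUnit x) :
    IsUnit (x + ε * σ x) ∨ IsUnit (x * ω + ε * σ (x * ω)) := by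
  rw [map_mul, ← mul_assoc]
  exact reIm_nonCancellation σ ε ω x hω hx

/-- **Step (e)/(f) packaged**: a set of «periods» stable under `y ↦ y ω` that contains a unit contains some `y` with `y + ε σy` a unit
(informally: the periods of a Néron-primitive `ω_g` form `Ω·ℓ_g(𝔐)·𝒪_K` with `ℓ_g` primitive, and `min_γ v_𝔓(2 Re ∫_γ ω_g / Ω) = 0`). [folklore] -/
theorem exists_mem_isUnit_add_mul_map (σ : R →+* R) (ε ω : R) (hω : IsUnit (ω - σ ω)) (L : Set R)
    (hL : ∀ y ∈ L, y * ω ∈ L) {x : R} (hxL : x ∈ L) (hx : IsUnit x) :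
    ∃ y ∈ L, IsUnit (y + ε * σ y) := by
  rcases reIm_nonCancellation' σ ε ω x hω hx with h | h
  · exact ⟨x, hxL, h⟩
  · exact ⟨x * ω, hL x hxL, h⟩

omit [IsLocalRing R] in
/-- The hypothesis «`ω − σω` is a unit» in the card's instance: if `ω + σ ω = 1` (informally `ω = (1+√d)/2`, `σω = (1−√d)/2`) then
`ω − σω = 2ω − 1` (informally `√d`), so it is a unit as soon as `(2ω − 1)² = d` is (informally `d_K ≡ 5 (mod 8)` odd ⇒ `2`-unit). [folklore] -/
theorem isUnit_sub_map_of_trace_one (σ : R →+* R) (ω d : R) (htr : ω + σ ω = 1) (hsq : (2 * ω - 1) ^ 2 = d) (hd : IsUnit d) :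
    IsUnit (ω - σ ω) := by
  have h1 : ω - σ ω = 2 * ω - 1 := by linear_combination (-1 : R) * htr
  rw [h1]
  rw [← hsq] at hd
  exact (isUnit_pow_iff two_ne_zero).mp hd

end NonCancellation

/-! ## Primitivity of a ring homomorphism as a vector (step (b) / P3 core) and the order-3 trace unit (step (g)) -/

section Primitive

variable {T O : Type*} [Semiring T] [CommSemiring O]

/-- A ring homomorphism is a PRIMITIVE vector of `Hom(T, O)`: if `λ t = p * μ t` for all `t` then `p` is a unit (evaluate at `1`).
(Card, step (b): under `S_g ⊗ ℤ̄₂ = Hom(𝒪_g ⊗ ℤ₂, ℤ̄₂)` the newform `g` is the ring map `ι` itself, primitive because `ι(1) = 1`.) [folklore] -/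
theorem isUnit_of_ringHom_eq_mul (lam : T →+* O) (p : O) (μ : T → O) (h : ∀ t, lam t = p * μ t) : IsUnit p := by
  have h1 : p * μ 1 = 1 := by rw [← h 1, map_one]
  exact IsUnit.of_mul_eq_one (μ 1) h1

end Primitive

section OrderThree

variable {k : Type*} [CommRing k] [CharP k 2]

/-- In characteristic `2`, a primitive cube root of unity has trace `ζ + ζ² = 1` (`= −1`). [folklore] -/
theorem add_sq_eq_one_of_cube_root {ζ : k} (hζ : ζ ^ 2 + ζ + 1 = 0) : ζ + ζ ^ 2 = 1 := by
  have h2 : (2 : k) = 0 := CharP.cast_eq_zero k 2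
  linear_combination hζ - h2

/-- **Step (g)**: in characteristic `2`, for `ζ² + ζ + 1 = 0` and `ℓ` odd, `(ζ + ζ²) − ℓ − 1 = 1`; informally the Hecke eigenvalue
`a_ℓ(g) ≡ ζ + ζ²` of a Frobenius of order `3` (ℓ split in `K`, odd) makes `a_ℓ(g) − ℓ − 1` a `𝔓`-unit, so the Eisenstein-type operator
`T_ℓ − ℓ − 1` (which closes the relative symbols `{∞, r}`) is invertible on the `g`-part. [folklore] -/
theorem trace_orderThree_sub_sub_one {ζ : k} (hζ : ζ ^ 2 + ζ + 1 = 0) {ℓ : ℕ} (hℓ : Odd ℓ) :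
    (ζ + ζ ^ 2) - (ℓ : k) - 1 = 1 := by
  obtain ⟨r, rfl⟩ := hℓ
  have h2 : (2 : k) = 0 := CharP.cast_eq_zero k 2
  rw [add_sq_eq_one_of_cube_root hζ]
  push_cast
  linear_combination (-(r : k) - 1) * h2

end OrderThree

end Summit.BirchSwinnertonDyer.BirchSwinnertonDyer.Theorems.SignedMuAtTwo.CMManinPeriod
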